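import Summits.CriticalPhenomena.PercolationContinuityZ3.Theorems.PercNearOneGluingNoHeavyLowerTailFourPointExchangeB
import Summits.CriticalPhenomena.PercolationContinuityZ3.Theorems.PercNearOneGluingNoHeavyLowerTailL1CertDict
import Summits.CriticalPhenomena.PercolationContinuityZ3.Theorems.PercNearOneGluingNoHeavyLowerTailCubicFourPointL1ThmCertCells
import Summits.CriticalPhenomena.PercolationContinuityZ3.Theorems.PercNearOneGluingNoHeavyLowerTailSwitchRelaxGR3Measure

/-!
# A new four-point exchange inequality, type D (all `n`): `μ(a|b|cy)·μ(ac|by) ≤ μ(ac|b|y)·μ(a|bcy)`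

Support file for crux `stmt-CriticalPhenomena-4575` (master-family programme, row `Q44`, single-source packing;
MONO-A line), seat `prim-bnk-1` gen 33; memo `run/shared/lean/prim/prim-l12/FROM-prim-bnk-1-gen33-LAW-LEVEL-MONO-A.md` §3.

Cell numbering of `FourPointAtoms.pat4`
(`0 a|b|c|y, 1 a|b|cy, 2 a|by|c, 3 a|bc|y, 4 ay|b|c, 5 ac|b|y, 6 ab|c|y, 7 a|bcy, 8 ay|bc, 9 ac|by, 10 acy|b, 11 ab|cy, 12 aby|c, 13 abc|y, 14 abcy`).
**Type D** (`typeD_cell`): `cell 1 · cell 9 ≤ cell 5 · cell 7`, i.e. `μ(a|b|cy)·μ(ac|by) ≤ μ(ac|b|y)·μ(a|bcy)` — the law-level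
form of the fibre inequality `Λ` of the gen-32 MONO-A memo §2(b) ("the smallest genuinely new statement of the programme");
it gives E-MONO-A for the terminal–terminal source edges `ab`, `ac` (memo gen-33 §4).  Odds form
`P(b↔y | a↔c, a↮{b,y}) ≤ P(b↔y | a↮{b,y}) ≤ P(b↔y | a↮{b,c,y}) ≤ P(b↔y | c↔y, a↮{b,c,y})`: three conditional Harris
inequalities (`typeD_d1`, `typeD_d2` between the cluster function `1{c ∈ C_a}` and the off-cluster event `{b↔y}` given
`{a ↮ b,y}`; `typeD_d3` between `{b↔y}`, `{c↔y}` given `{a ↮ b,c,y}`), the dictionary events ↦ cells, and the elementary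
elimination `typeD_alg`.  Numerically type D lies OUTSIDE the two-set BHK exchange cone.  No named facts, no sorries, no definitions.
-/

noncomputable section

namespace Summit.CriticalPhenomena.PercolationContinuityZ3.Theorems

namespace FourPointExchange

open MeasureTheory Set Literature.Probability.Percolation Literature.Probability.Percolation.BHK2006
open Literature.Probability.LatticeModels (prodBernoulli)
open DecisionTree (ind ind_of_mem ind_of_not_mem ind_nonneg)
open CondHarris FourPointAtoms
open Summit.CriticalPhenomena.PercolationContinuityZ3.Cruxes.AdditiveGluing.TieLine.ConnAtoms
open scoped Classical

variable {V : Type}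

variable [Fintype V] (w : Sym2 V → unitInterval) (a b c y : V)

/-! ## Type D: `μ(a|b|cy) μ(ac|by) ≤ μ(ac|b|y) μ(a|bcy)` -/

section dictD
/-! Dictionary for type D (`R = {a ↮ b} ∩ {a ↮ y}`, `Y_a = {a ↮ b} ∩ {a ↮ c} ∩ {a ↮ y}`). -/

/-- `μ({a↔c} ∩ {b↔y} ∩ {a ↮ b,y}) = cell 9`. [this work] -/
theorem realD_acbyR : (prodBernoulli w).real (openConn a c ∩ openConn b y ∩ ((openConn a b)ᶜ ∩ (openConn a y)ᶜ)) =
    cell w a b c y 9 := by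
  rw [measureReal_eq_cellSum w a b c y (show HasPattern (quad a b c y)
      (openConn a c ∩ openConn b y ∩ ((openConn a b)ᶜ ∩ (openConn a y)ᶜ)) _ from
    (((oc a b c y 0 2 rfl rfl).inter (oc a b c y 1 3 rfl rfl)).inter
      ((oc a b c y 0 1 rfl rfl).compl.inter (oc a b c y 0 3 rfl rfl).compl)))]
  simp (config := {decide := true}) only [ite_true, ite_false]; ring

/-- `μ({a↔c} ∩ {a ↮ b,y}) = cell 5 + cell 9`. [this work] -/
theorem realD_acR : (prodBernoulli w).real (openConn a c ∩ ((openConn a b)ᶜ ∩ (openConn a y)ᶜ)) =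
    cell w a b c y 5 + cell w a b c y 9 := by
  rw [measureReal_eq_cellSum w a b c y (show HasPattern (quad a b c y)
      (openConn a c ∩ ((openConn a b)ᶜ ∩ (openConn a y)ᶜ)) _ from
    ((oc a b c y 0 2 rfl rfl).inter ((oc a b c y 0 1 rfl rfl).compl.inter (oc a b c y 0 3 rfl rfl).compl)))]
  simp (config := {decide := true}) only [ite_true, ite_false]; ring

/-- `μ({b↔y} ∩ {a ↮ b,y}) = cell 2 + cell 7 + cell 9`. [this work] -/
theorem realD_byR : (prodBernoulli w).real (openConn b y ∩ ((openConn a b)ᶜ ∩ (openConn a y)ᶜ)) =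
    cell w a b c y 2 + cell w a b c y 7 + cell w a b c y 9 := by
  rw [measureReal_eq_cellSum w a b c y (show HasPattern (quad a b c y)
      (openConn b y ∩ ((openConn a b)ᶜ ∩ (openConn a y)ᶜ)) _ from
    ((oc a b c y 1 3 rfl rfl).inter ((oc a b c y 0 1 rfl rfl).compl.inter (oc a b c y 0 3 rfl rfl).compl)))]
  simp (config := {decide := true}) only [ite_true, ite_false]; ring

/-- `μ({a↮c} ∩ {b↔y} ∩ {a ↮ b,y}) = cell 2 + cell 7`. [this work] -/
theorem realD_nacbyR : (prodBernoulli w).real ((openConn a c)ᶜ ∩ openConn b y ∩ ((openConn a b)ᶜ ∩ (openConn a y)ᶜ)) =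
    cell w a b c y 2 + cell w a b c y 7 := by
  rw [measureReal_eq_cellSum w a b c y (show HasPattern (quad a b c y)
      ((openConn a c)ᶜ ∩ openConn b y ∩ ((openConn a b)ᶜ ∩ (openConn a y)ᶜ)) _ from
    (((oc a b c y 0 2 rfl rfl).compl.inter (oc a b c y 1 3 rfl rfl)).inter
      ((oc a b c y 0 1 rfl rfl).compl.inter (oc a b c y 0 3 rfl rfl).compl)))]
  simp (config := {decide := true}) only [ite_true, ite_false]; ring

/-- `μ({b↔y} ∩ {a ↮ b,c,y}) = cell 2 + cell 7`. [this work] -/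
theorem realD_byYa : (prodBernoulli w).real (openConn b y ∩ ((openConn a b)ᶜ ∩ (openConn a c)ᶜ ∩ (openConn a y)ᶜ)) =
    cell w a b c y 2 + cell w a b c y 7 := by
  rw [measureReal_eq_cellSum w a b c y (show HasPattern (quad a b c y)
      (openConn b y ∩ ((openConn a b)ᶜ ∩ (openConn a c)ᶜ ∩ (openConn a y)ᶜ)) _ from
    ((oc a b c y 1 3 rfl rfl).inter
      (((oc a b c y 0 1 rfl rfl).compl.inter (oc a b c y 0 2 rfl rfl).compl).inter (oc a b c y 0 3 rfl rfl).compl)))]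
  simp (config := {decide := true}) only [ite_true, ite_false]; ring

/-- `μ({c↔y} ∩ {a ↮ b,c,y}) = cell 1 + cell 7`. [this work] -/
theorem realD_cyYa : (prodBernoulli w).real (openConn c y ∩ ((openConn a b)ᶜ ∩ (openConn a c)ᶜ ∩ (openConn a y)ᶜ)) =
    cell w a b c y 1 + cell w a b c y 7 := by
  rw [measureReal_eq_cellSum w a b c y (show HasPattern (quad a b c y)
      (openConn c y ∩ ((openConn a b)ᶜ ∩ (openConn a c)ᶜ ∩ (openConn a y)ᶜ)) _ from
    ((oc a b c y 2 3 rfl rfl).inter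
      (((oc a b c y 0 1 rfl rfl).compl.inter (oc a b c y 0 2 rfl rfl).compl).inter (oc a b c y 0 3 rfl rfl).compl)))]
  simp (config := {decide := true}) only [ite_true, ite_false]; ring

/-- `μ({b↔y} ∩ {c↔y} ∩ {a ↮ b,c,y}) = cell 7`. [this work] -/
theorem realD_bycyYa : (prodBernoulli w).real (openConn b y ∩ openConn c y ∩
      ((openConn a b)ᶜ ∩ (openConn a c)ᶜ ∩ (openConn a y)ᶜ)) = cell w a b c y 7 := by
  rw [measureReal_eq_cellSum w a b c y (show HasPattern (quad a b c y)
      (openConn b y ∩ openConn c y ∩ ((openConn a b)ᶜ ∩ (openConn a c)ᶜ ∩ (openConn a y)ᶜ)) _ from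
    (((oc a b c y 1 3 rfl rfl).inter (oc a b c y 2 3 rfl rfl)).inter
      (((oc a b c y 0 1 rfl rfl).compl.inter (oc a b c y 0 2 rfl rfl).compl).inter (oc a b c y 0 3 rfl rfl).compl)))]
  simp (config := {decide := true}) only [ite_true, ite_false]; ring

end dictD

/-- Type D, step (D1): given `{a ↮ b,y}`, `{a ↔ c}` and `{b ↔ y}` are negatively correlated — in cells,
`μ(R)·c9 ≤ (c5+c9)·(c2+c7+c9)` with `μ(R) = c0+c1+c2+c3+c5+c7+c9`. [this work] -/
theorem typeD_d1 (ha : a ∉ ({b, y} : Set V)) :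
    (cell w a b c y 0 + cell w a b c y 1 + cell w a b c y 2 + cell w a b c y 3 + cell w a b c y 5 + cell w a b c y 7 +
      cell w a b c y 9) * cell w a b c y 9 ≤
    (cell w a b c y 5 + cell w a b c y 9) * (cell w a b c y 2 + cell w a b c y 7 + cell w a b c y 9) := by
  have hb : b ∈ ({b, y} : Set V) := by simp
  have d1 := condHarris_cluster_mono_off_mono w a ({b, y} : Set V) ha (clusterFn_monotone a c) (ind_openConn_monotone b y)
    (ind_openConn_off hb)
  simp only [← ind_openConn_eq_clusterFn] at d1
  rw [← real_inter_Dis, ← real_inter_Dis, ← measureReal_eq_sum, ← real_inter_inter_Dis, Dis_two_eq,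
    FourPointAtoms.real_xDabDay, realD_acbyR, realD_acR, realD_byR] at d1
  exact d1

/-- Type D, step (D2): given `{a ↮ b,y}`, `{a ↮ c}` and `{b ↔ y}` are positively correlated — in cells,
`(c0+c1+c2+c3+c7)·(c2+c7+c9) ≤ μ(R)·(c2+c7)`. [this work] -/
theorem typeD_d2 (ha : a ∉ ({b, y} : Set V)) :
    (cell w a b c y 0 + cell w a b c y 1 + cell w a b c y 2 + cell w a b c y 3 + cell w a b c y 7) *
      (cell w a b c y 2 + cell w a b c y 7 + cell w a b c y 9) ≤
    (cell w a b c y 0 + cell w a b c y 1 + cell w a b c y 2 + cell w a b c y 3 + cell w a b c y 5 + cell w a b c y 7 +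
      cell w a b c y 9) * (cell w a b c y 2 + cell w a b c y 7) := by
  have hb : b ∈ ({b, y} : Set V) := by simp
  have d2 := condHarris_cluster_anti_off_mono w a ({b, y} : Set V) ha (one_sub_clusterFn_antitone a c)
    (ind_openConn_monotone b y) (ind_openConn_off hb)
  simp only [← ind_openConn_eq_clusterFn, one_sub_ind_openConn] at d2
  rw [← real_inter_Dis, ← real_inter_Dis, ← measureReal_eq_sum, ← real_inter_inter_Dis, Dis_two_eq,
    FourPointAtoms.real_xDabDay, L1ThmCert.rE8, realD_byR, realD_nacbyR] at d2
  exact d2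

/-- Type D, step (D3): given `{a ↮ b,c,y}`, `{b ↔ y}` and `{c ↔ y}` are positively correlated — in cells,
`(c2+c7)·(c1+c7) ≤ (c0+c1+c2+c3+c7)·c7`. [this work] -/
theorem typeD_d3 (ha : a ∉ ({b, c, y} : Set V)) :
    (cell w a b c y 2 + cell w a b c y 7) * (cell w a b c y 1 + cell w a b c y 7) ≤
    (cell w a b c y 0 + cell w a b c y 1 + cell w a b c y 2 + cell w a b c y 3 + cell w a b c y 7) * cell w a b c y 7 := by
  have hb : b ∈ ({b, c, y} : Set V) := by simp
  have hc : c ∈ ({b, c, y} : Set V) := by simp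
  have d3 := condHarris_off_mono_mono w a ({b, c, y} : Set V) ha (ind_openConn_monotone b y) (ind_openConn_monotone c y)
    (fun _ => ind_nonneg _ _) (fun _ => ind_nonneg _ _) (ind_openConn_off hb) (ind_openConn_off hc)
  rw [← real_inter_Dis, ← real_inter_Dis, ← measureReal_eq_sum, ← real_inter_inter_Dis, Dis_three_eq,
    realD_byYa, realD_cyYa, SwitchRelax.GR3.rE0, realD_bycyYa] at d3
  exact d3

omit [Fintype V] in
/-- The arithmetic of the type-D chain: from (D1)–(D3) and nonnegativity, `c1·c9 ≤ c5·c7`. [this work] -/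
theorem typeD_alg {c0 c1 c2 c3 c5 c7 c9 : ℝ} (h0 : 0 ≤ c0) (h1 : 0 ≤ c1) (h2 : 0 ≤ c2) (h3 : 0 ≤ c3) (h5 : 0 ≤ c5)
    (h7 : 0 ≤ c7) (h9 : 0 ≤ c9)
    (d1 : (c0 + c1 + c2 + c3 + c5 + c7 + c9) * c9 ≤ (c5 + c9) * (c2 + c7 + c9))
    (d2 : (c0 + c1 + c2 + c3 + c7) * (c2 + c7 + c9) ≤ (c0 + c1 + c2 + c3 + c5 + c7 + c9) * (c2 + c7))
    (d3 : (c2 + c7) * (c1 + c7) ≤ (c0 + c1 + c2 + c3 + c7) * c7) : c1 * c9 ≤ c5 * c7 := by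
  by_cases hc1 : c1 = 0
  · rw [hc1, zero_mul]; exact mul_nonneg h5 h7
  by_cases hc9 : c9 = 0
  · rw [hc9, mul_zero]; exact mul_nonneg h5 h7
  have hc1' : 0 < c1 := lt_of_le_of_ne h1 (Ne.symm hc1)
  have hc9' : 0 < c9 := lt_of_le_of_ne h9 (Ne.symm hc9)
  have hS : 0 < c2 + c7 + c9 := by linarith
  have hYa : 0 < c0 + c1 + c2 + c3 + c7 := by linarith
  have hT0 : 0 ≤ c2 + c7 := by linarith
  have hT : 0 < c2 + c7 := by
    rcases eq_or_lt_of_le hT0 with h | h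
    · exfalso
      rw [← h, mul_zero] at d2
      nlinarith [mul_pos hYa hS]
    · exact h
  have key : ((c2 + c7) * (c2 + c7 + c9)) * (c9 * (c1 + c7)) ≤ ((c2 + c7) * (c2 + c7 + c9)) * (c7 * (c5 + c9)) :=
    calc ((c2 + c7) * (c2 + c7 + c9)) * (c9 * (c1 + c7))
        = (c2 + c7 + c9) * (c9 * ((c2 + c7) * (c1 + c7))) := by ring
      _ ≤ (c2 + c7 + c9) * (c9 * ((c0 + c1 + c2 + c3 + c7) * c7)) :=
          mul_le_mul_of_nonneg_left (mul_le_mul_of_nonneg_left d3 h9) hS.le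
      _ = (c9 * c7) * ((c0 + c1 + c2 + c3 + c7) * (c2 + c7 + c9)) := by ring
      _ ≤ (c9 * c7) * ((c0 + c1 + c2 + c3 + c5 + c7 + c9) * (c2 + c7)) :=
          mul_le_mul_of_nonneg_left d2 (mul_nonneg h9 h7)
      _ = (c7 * (c2 + c7)) * ((c0 + c1 + c2 + c3 + c5 + c7 + c9) * c9) := by ring
      _ ≤ (c7 * (c2 + c7)) * ((c5 + c9) * (c2 + c7 + c9)) := mul_le_mul_of_nonneg_left d1 (mul_nonneg h7 hT0)
      _ = ((c2 + c7) * (c2 + c7 + c9)) * (c7 * (c5 + c9)) := by ring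
  have key' := le_of_mul_le_mul_left key (mul_pos hT hS)
  nlinarith [key', mul_nonneg h7 h9]

/-- **Type D exchange inequality** (all `n`, all marked points): `μ(a|b|cy) · μ(ac|by) ≤ μ(ac|b|y) · μ(a|bcy)` — the
law-level form of the fibre inequality `Λ` of the MONO-A memo. [this work] -/
theorem typeD_cell : cell w a b c y 1 * cell w a b c y 9 ≤ cell w a b c y 5 * cell w a b c y 7 := by
  have h5 := cell_nonneg w a b c y 5
  have h7 := cell_nonneg w a b c y 7
  -- coincidences: if `a ∈ {b, y}` then `cell 9 = 0`; if `a = c` (so `a ∈ {b,c,y}`) then `cell 1 = 0`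
  by_cases ha2 : a ∈ ({b, y} : Set V)
  · have h := realD_acbyR w a b c y
    rw [← Dis_two_eq, Dis_eq_empty ha2, Set.inter_empty, measureReal_empty] at h
    rw [← h, mul_zero]; exact mul_nonneg h5 h7
  by_cases ha3 : a ∈ ({b, c, y} : Set V)
  · have h := realD_cyYa w a b c y
    rw [← Dis_three_eq, Dis_eq_empty ha3, Set.inter_empty, measureReal_empty] at h
    have hc1 : cell w a b c y 1 = 0 := by linarith [cell_nonneg w a b c y 1, cell_nonneg w a b c y 7]
    rw [hc1, zero_mul]; exact mul_nonneg h5 h7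
  exact typeD_alg (cell_nonneg w a b c y 0) (cell_nonneg w a b c y 1) (cell_nonneg w a b c y 2) (cell_nonneg w a b c y 3)
    h5 h7 (cell_nonneg w a b c y 9) (typeD_d1 w a b c y ha2) (typeD_d2 w a b c y ha2) (typeD_d3 w a b c y ha3)

end FourPointExchange

end Summit.CriticalPhenomena.PercolationContinuityZ3.Theorems
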